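import Summits.CriticalPhenomena.PercolationContinuityZ3.Theorems.Transplant.FKConnectivityAllQUniformPairGluing
import Summits.CriticalPhenomena.PercolationContinuityZ3.Theorems.Transplant.FKConnectivityAllQMixedLevelGluing
import Summits.CriticalPhenomena.PercolationContinuityZ3.Theorems.Transplant.FKConnectivityAllQCountReweightedCex
import HarnessLib

/-!
# ADDITIVE GLUING IS NOT UNIVERSAL OVER CLUSTER-COUNT REWEIGHTINGS: kernel refutation of `AdditiveGluingCountPos` (fk-1 g9) — hence of
# `MixedLevelGluingPos` (g11) and `UniformPairSlackBilevelPos` (g12) — by a weighted 7-vertex graph and a NON-DECREASING count weight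

Support file (`--supports stmt-CriticalPhenomena-4575`), FK sub-lane `prim-bschramm-fk-1` (gen 12) of the post-continuity programme; builds on
p205010 (kernel theorem, internal audit signed; external expert review pending).  One listed weighted graph and computable Boolean predicates;
no `Prop` definitions, no named facts, no sorries; standard axioms (`decide +kernel`).  Nothing here bears on p205010 (product measure).

THE CORRECTION.  Since fk-1 g9 the lane's working answer to 'for which class of measures do the finite links of the chain hold?' was: Kozma–Nitzan's
additive gluing holds for EVERY cluster-count reweighting `μ_h ∝ P_w·h(k)`, `h > 0` (`AdditiveGluingCountPos`; censuses g9–g11 and ttrl cp-hp5: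
0 violations in ≈ 9·10⁶ placements with random weights; g11: ⟺ `MixedLevelGluingPos` by minimax).  The ADVERSARIAL exact census of this seat
(kit j133841: 20,016,000 placements on 6–9-vertex graphs with NEAR-DETERMINISTIC integer weights, exact integers) finds PER-LEVEL failures of
additive gluing — placements where at ONE level `j` every relay fails — in 15 placements (n = 6..9, |A| = 2..4); a positive count weight
concentrated at that level then violates additive gluing.  The witness certified here (smallest margins are ≈ 10⁻⁴ relative, which is why
random-weight censuses never met them):

* graph on `Fin 7`: pairs `02, 03, 04, 12, 15, 34, 36, 56`, parameters `99/100` except `12 ↦ 1/2` (the kit witness had two more pairs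
  `05, 24` at `1/100`; deleting them keeps the violation and brings the certificate to `2⁸` configurations); source `o = 0`, target `b = 1`,
  relays `A = {2, 3}`; count weight **`h(k) = 1` for `k ≥ 3`, `h(k) = 10⁻⁶` for `k ≤ 2`** — POSITIVE and NON-DECREASING (a step;
  log-concave at the step);
* `μ_h(o ↔ A) − max_a μ_h(a ↮ b) − μ_h(o ↔ b) = 75802787297/(3.125·10¹⁸·Z_h) ≈ +7.9·10⁻⁵ > 0` (exact; `Z_h ≈ 3.05·10⁻⁴`), i.e. the hypothesis
  of `AdditiveGluingUnder` holds with `t = μ_h(2 ↮ 1)` and its conclusion fails.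

CONSEQUENCES (kernel): **`not_additiveGluingCountPos`**; **`not_mixedLevelGluingPos`** (via g11's `additiveGluingCountPos_of_mixedLevelGluingPos`);
**`not_uniformPairSlackBilevelPos`** (via g12's `additiveGluingCountPos_of_uniformPairSlackBilevelPos`; ERRATUM to that node's evidence line —
the adversarial census finds 15 direct failures as well); `not_additiveGluing_count_monotone` (even non-decreasing `h` fail).  WHAT SURVIVES: the
random-cluster weights — `FK.AdditiveGluingFKPos` (`h = q^k`, every `q > 0`): on this witness additive gluing holds for `q ∈ {10⁻⁶, 10⁻³, 1/10, 1/2,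
2, 10, 10³}`, for `k!`, `2^{k²}`, `1/k!`, `k^{±5}` (seat numerics, exact); every failure found needs a level-concentrated (log-concave step) weight on
near-deterministic parameters.  Working conjecture after g12 (memo bschramm/FROM-fk-1-g12-SLACK-FOURPOINT.md §8): additive gluing for every
LOG-CONVEX count weight (a convex class containing all `q^k` and their mixtures; g10: GEN / AG-loc census-exact on that class).
[cite: KozmaNitzan2024, Conj. 1 (p. 3); Thm. 1 (p. 7)] [cite: Grimmett2006, §1.4 eq. (1.20) (p. 15); §3.9 (pp. 63–65)]
-/

namespace Summit.CriticalPhenomena.PercolationContinuityZ3.Theorems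

namespace FK

open MeasureTheory Set Literature.Probability.LatticeModels Literature.Probability.Percolation

namespace CountGluingCex

/-- The listed weighted graph on `Fin 7`: pairs `02,03,04,12,15,34,36,56`, parameters `99/100` (×7) and `1/2` (pair `12`); `q = 1` dummy.
[cite: Grimmett2006, §1.4 eq. (1.20) (p. 15)] -/
abbrev d7 : RCEval :=
  ⟨7, 8, ![0, 0, 0, 1, 1, 3, 3, 5], ![2, 3, 4, 2, 5, 4, 6, 6],
    ![99 / 100, 99 / 100, 99 / 100, 1 / 2, 99 / 100, 99 / 100, 99 / 100, 99 / 100], 1⟩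

/-- Validity of the data set. [folklore] -/
theorem valid : d7.Valid := by decide +kernel

/-- The non-decreasing positive count weight `h(k) = 1 (k ≥ 3)`, `10⁻⁶ (k ≤ 2)` (rational side). [folklore] -/
def hQ (k : ℕ) : ℚ := if 3 ≤ k then 1 else 1 / 1000000

/-- The same weight, real side. [folklore] -/
noncomputable def hR (k : ℕ) : ℝ := if 3 ≤ k then 1 else 1 / 1000000

/-- `{o ↔ A} = {0 ↔ 2} ∪ {0 ↔ 3}` as a Boolean. [folklore] -/
def pOA (t : Finset (Fin 8)) : Bool := d7.reachB t 0 2 || d7.reachB t 0 3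
/-- `{o ↔ b} = {0 ↔ 1}`. [folklore] -/
def pOB (t : Finset (Fin 8)) : Bool := d7.reachB t 0 1
/-- `{2 ↔ 1}`. [folklore] -/
def pAB (t : Finset (Fin 8)) : Bool := d7.reachB t 2 1
/-- `{3 ↔ 1}`. [folklore] -/
def pCB (t : Finset (Fin 8)) : Bool := d7.reachB t 3 1

/-- `μ_h`-mass of `{o ↔ A}` (unnormalised). [cite: Grimmett2006, §1.4 eq. (1.20) (p. 15)] -/
theorem mOA : d7.masshQ hQ pOA = 12173623905763881 / 40000000000000000000 := by decide +kernel
/-- `μ_h`-mass of `{o ↔ b}`. [cite: Grimmett2006, §1.4 eq. (1.20) (p. 15)] -/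
theorem mOB : d7.masshQ hQ pOB = 403713082227807 / 200000000000000000000 := by decide +kernel
/-- `μ_h`-mass of `{2 ↔ 1}`. [cite: Grimmett2006, §1.4 eq. (1.20) (p. 15)] -/
theorem mAB : d7.masshQ hQ pAB = 614445450734017 / 200000000000000000000 := by decide +kernel
/-- `μ_h`-mass of `{3 ↔ 1}`. [cite: Grimmett2006, §1.4 eq. (1.20) (p. 15)] -/
theorem mCB : d7.masshQ hQ pCB = 685069323790401 / 200000000000000000000 := by decide +kernel
/-- `Z_h`. [cite: Grimmett2006, §1.4 eq. (1.20) (p. 15)] -/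
theorem zh : d7.ZhQ hQ = 61074000518938607 / 200000000000000000000 := by decide +kernel

noncomputable section

open scoped Classical

/-- Membership `{o ↔ A}` in Boolean form. [folklore] -/
theorem mem_pOA (t : Finset (Fin 8)) :
    d7.conf t ∈ (⋃ a ∈ ({2, 3} : Finset (Fin 7)), (openConn (0 : Fin 7) a : Set (BondConfig (Fin 7)))) ↔ pOA t = true := by
  have e02 := d7.reachB_iff t 0 2
  have e03 := d7.reachB_iff t 0 3
  simp only [Set.mem_iUnion, Finset.mem_insert, Finset.mem_singleton, exists_prop, mem_openConn_iff', pOA, Bool.or_eq_true, e02, e03]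
  constructor
  · rintro ⟨a, ha, hr⟩
    rcases ha with rfl | rfl
    · exact Or.inl hr
    · exact Or.inr hr
  · rintro (h | h)
    · exact ⟨2, Or.inl rfl, h⟩
    · exact ⟨3, Or.inr rfl, h⟩

/-- Membership `{0 ↔ 1}`. [folklore] -/
theorem mem_pOB (t : Finset (Fin 8)) : d7.conf t ∈ (openConn (0 : Fin 7) 1 : Set (BondConfig (Fin 7))) ↔ pOB t = true :=
  (d7.reachB_iff t 0 1).symm
/-- Membership `{2 ↔ 1}`. [folklore] -/
theorem mem_pAB (t : Finset (Fin 8)) : d7.conf t ∈ (openConn (2 : Fin 7) 1 : Set (BondConfig (Fin 7))) ↔ pAB t = true :=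
  (d7.reachB_iff t 2 1).symm
/-- Membership `{3 ↔ 1}`. [folklore] -/
theorem mem_pCB (t : Finset (Fin 8)) : d7.conf t ∈ (openConn (3 : Fin 7) 1 : Set (BondConfig (Fin 7))) ↔ pCB t = true :=
  (d7.reachB_iff t 3 1).symm

/-- Real and rational weights agree. [folklore] -/
theorem h_eq (k : ℕ) : hR k = ((hQ k : ℚ) : ℝ) := by
  unfold hR hQ
  by_cases hk : 3 ≤ k
  · simp [hk]
  · simp [hk]

/-- The weight is positive. [folklore] -/
theorem h_pos (k : ℕ) : 0 < hR k := by
  unfold hR; split_ifs <;> norm_num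

/-- The weight is non-decreasing. [folklore] -/
theorem h_mono : Monotone hR := by
  intro i j hij
  unfold hR
  by_cases hi : 3 ≤ i
  · rw [if_pos hi, if_pos (le_trans hi hij)]
  · rw [if_neg hi]
    split_ifs <;> norm_num

end

end CountGluingCex

noncomputable section

open scoped Classical
open CountGluingCex

/-- **Additive gluing fails under the count weight `hR` on the witness**: with `t = μ_h(2 ↮ 1)` (the larger of the two relay defects) the
hypothesis `1 − t ≤ μ_h(a ↔ 1)` holds for `a = 2, 3` but `μ_h(0 ↔ {2,3}) − t > μ_h(0 ↔ 1)`. [cite: KozmaNitzan2024, Conj. 1 (p. 3)]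
[cite: Grimmett2006, §1.4 eq. (1.20) (p. 15)] -/
theorem not_additiveGluingUnder_count_witness : ¬ AdditiveGluingUnder (crMeasure d7.w hR) ({2, 3} : Finset (Fin 7)) 0 1 := by
  intro H
  have hZ : (0 : ℝ) < ((d7.ZhQ hQ : ℚ) : ℝ) := by rw [zh]; norm_num
  have rOA := RCEval.cr_real_eq_masshQ_div valid h_eq h_pos (P := pOA) mem_pOA
  have rOB := RCEval.cr_real_eq_masshQ_div valid h_eq h_pos (P := pOB) mem_pOB
  have rAB := RCEval.cr_real_eq_masshQ_div valid h_eq h_pos (P := pAB) mem_pAB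
  have rCB := RCEval.cr_real_eq_masshQ_div valid h_eq h_pos (P := pCB) mem_pCB
  have key := H (1 - (crMeasure d7.w hR).real (openConn (2 : Fin 7) 1)) ?_ ?_
  · rw [rOA, rOB, rAB, mOA, mOB, mAB, zh] at key
    push_cast at key
    norm_num at key
  · rw [rAB, mAB, zh]; push_cast; norm_num
  · intro a ha
    simp only [Finset.mem_insert, Finset.mem_singleton] at ha
    rcases ha with rfl | rfl
    · linarith
    · rw [rAB, rCB, mAB, mCB, zh]; push_cast; norm_num

/-- **`¬ AdditiveGluingCountPos`**: Kozma–Nitzan's additive gluing does NOT hold under every positive cluster-count reweighting of a product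
measure (fk-1 g9's node; the censuses of g9–g11 used random weights).  The failing weight here is even non-decreasing.
[cite: KozmaNitzan2024, Conj. 1 (p. 3)] [cite: Grimmett2006, §1.4 eq. (1.20) (p. 15); §3.9 (pp. 63–65)] -/
theorem not_additiveGluingCountPos : ¬ AdditiveGluingCountPos := fun H =>
  not_additiveGluingUnder_count_witness (H 7 d7.w hR h_pos {2, 3} 0 1)

/-- **Even a NON-DECREASING positive count weight violates additive gluing.** [cite: KozmaNitzan2024, Conj. 1 (p. 3)] -/
theorem not_additiveGluing_count_monotone :
    ¬ ∀ (n : ℕ) (w : Sym2 (Fin n) → unitInterval) (h : ℕ → ℝ), (∀ k, 0 < h k) → Monotone h →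
        ∀ (A : Finset (Fin n)) (o b : Fin n), AdditiveGluingUnder (crMeasure w h) A o b := fun H =>
  not_additiveGluingUnder_count_witness (H 7 d7.w hR h_pos h_mono {2, 3} 0 1)

/-- **`¬ MixedLevelGluingPos`** (fk-1 g11's mixed-relay levelwise node): it implies `AdditiveGluingCountPos`.
[cite: KozmaNitzan2024, Conj. 1 (p. 3)] -/
theorem not_mixedLevelGluingPos : ¬ MixedLevelGluingPos := fun h =>
  not_additiveGluingCountPos (additiveGluingCountPos_of_mixedLevelGluingPos h)

/-- **`¬ UniformPairSlackBilevelPos`** (fk-1 g12's disjunction node; ERRATUM to its evidence sentence): it implies `AdditiveGluingCountPos`.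
[cite: KozmaNitzan2024, Conj. 1 (p. 3)] -/
theorem not_uniformPairSlackBilevelPos : ¬ UniformPairSlackBilevelPos := fun h =>
  not_additiveGluingCountPos (additiveGluingCountPos_of_uniformPairSlackBilevelPos h)

end

end FK

end Summit.CriticalPhenomena.PercolationContinuityZ3.Theorems
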